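import Literature.Dynamics.Contraction.ComplexConeContractionThm23

/-!
# Dubois 2009, Lemma 2.2 (1) (the gauge `δ_C` controls the norm up to a phase) — proof

Discharges the named fact `Literature.Dynamics.Contraction.Dubois2009_lemma_2_2_1` of
`Literature/Dynamics/Contraction/ComplexConeContraction.lean` (statement unchanged there) by
`Dubois2009_lemma_2_2_1_holds`, following the printed proof of

* L. Dubois, *Projective metrics and contraction principles for complex cones*, J. London Math.
  Soc. (2) 79 (2009) 719–737 = arXiv:0811.2930 [Dubois2009], Lemma 2.2 (1), proof p. 6 of the
  arXiv text (read 2026-08-15 on the held copy).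

Statement (print): let `C` be a proper complex cone of `K`-bounded sectional aperture; for
`x, y ∈ C`, `‖x‖ = ‖y‖ = 1`, there is `α ∈ ℂ`, `|α| = 1`, with `‖α y − x‖ ≤ K δ_C(x, y)`.

Architecture (printed proof ↦ declarations here).
* "Assume `x, y` independent and `δ_C(x,y) < ∞`" ↦ the case splits at the top of
  `Dubois2009_lemma_2_2_1_holds` (colinear pairs: `x = α y` with `|α| = 1` outright; `δ = ⊤`:
  trivial).
* "Take `m ∈ V'` satisfying (2.10) for the plane spanned by `x, y`; `x' = x/⟨m,x⟩`,
  `y' = y/⟨m,y⟩`" ↦ `m` from `HasBoundedSectionalAperture` on `span {x, y}` (of `finrank` 2 by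
  independence); we do not normalise `‖m‖ = 1` but carry the constant `K/‖m‖`.
* "`1 ∈ E_C(x',y')`, since otherwise `0 = K|⟨m, x'−y'⟩| ≥ ‖x'−y'‖`" ↦ `hz₀`
  (`⟨m,y⟩/⟨m,x⟩ ∈ E_C(x,y)`); this also gives `E_C(x,y) ≠ ∅` (properness is not needed beyond
  the cone property, exactly as in print).
* "Let `0 < a < inf|E(x',y')|`, `b > sup|E(x',y')|` … using (2.10),
  `‖x'−y'‖ ≤ (b−1)/(b−a) ‖ax'−y'‖ + (1−a)/(b−a) ‖bx'−y'‖ ≤ 2K (b−1)(1−a)/(b−a)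
  ≤ 2K (√b−√a)/(√b+√a) = 2K tanh(log(b/a)/4) ≤ (K/2) log(b/a)`" ↦ `norm_sub_le_half_mul_log`
  (the convex combination, the inequality `(b−1)(1−a) ≤ (√b−√a)²`, i.e. `(√(ab) − 1)² ≥ 0`, and
  `2 tanh(s/4) ≤ s/2` in the form `2(r−1)/(r+1) ≤ log r`, `two_mul_sub_one_div_add_one_le_log`,
  read off the artanh series `Real.hasSum_log_sub_log_of_abs_lt_one`); the limit `a ↑ inf`,
  `b ↓ sup` is `le_of_forall_pos_lt_add`. The sets `E(x',y') = (⟨m,x⟩/⟨m,y⟩) E(x,y)` enter only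
  through the two implications `|z| < inf|E| ⇒ zx − y ∈ C`, `|z| > sup|E| ⇒ zx − y ∈ C`.
* "Finally `‖αy − x‖ = ‖x'/‖x'‖ − y'/‖y'‖‖ ≤ 2‖x'−y'‖ / max(‖x'‖,‖y'‖) ≤ 2‖x'−y'‖`" ↦
  `norm_normalize_sub_normalize_le` and `‖x'‖ = 1/|⟨m,x⟩| ≥ 1/‖m‖`.
Completeness of `V` (in the fact's binders) is not used, as in print.

## References
* [Dubois2009] L. Dubois, J. London Math. Soc. (2) 79 (2009) 719–737 = arXiv:0811.2930,
  Def. 2, Def. 4 ((2.10)), Lemma 2.2 (1), p. 6.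
-/

noncomputable section

open scoped ENNReal
open Set

namespace Literature.Dynamics.Contraction

/-! ### Step 1: the scalar inequalities of the printed chain -/

/-- `2(r−1)/(r+1) ≤ log r` for `r ≥ 1`, i.e. `2 tanh(s/4) ≤ s/2` with `r = e^{s/2}` (the last
step of the displayed chain in the proof of Lemma 2.2 (1)); it is the first term of the artanh
series `log((1+w)/(1−w)) = 2 Σ w^{2k+1}/(2k+1)`, `w = (r−1)/(r+1)`. [folklore] -/
theorem two_mul_sub_one_div_add_one_le_log {r : ℝ} (hr : 1 ≤ r) :
    2 * (r - 1) / (r + 1) ≤ Real.log r := by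
  have hr0 : 0 < r := one_pos.trans_le hr
  have hr1 : 0 < r + 1 := by linarith
  have hr1' : r + 1 ≠ 0 := hr1.ne'
  obtain ⟨w, hw⟩ : ∃ w : ℝ, (r - 1) / (r + 1) = w := ⟨_, rfl⟩
  have hw0 : 0 ≤ w := by rw [← hw]; exact div_nonneg (by linarith) hr1.le
  have hw1 : w < 1 := by rw [← hw, div_lt_one hr1]; linarith
  have hwabs : |w| < 1 := by rwa [abs_of_nonneg hw0]
  have h := Real.hasSum_log_sub_log_of_abs_lt_one hwabs
  have h1 : 1 + w = 2 * r / (r + 1) := by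
    rw [← hw, eq_div_iff hr1', add_mul, div_mul_cancel₀ _ hr1']
    ring
  have h2 : 1 - w = 2 / (r + 1) := by
    rw [← hw, eq_div_iff hr1', sub_mul, div_mul_cancel₀ _ hr1']
    ring
  have hlog : Real.log (1 + w) - Real.log (1 - w) = Real.log r := by
    rw [h1, h2, Real.log_div (by positivity) hr1', Real.log_div two_ne_zero hr1',
      Real.log_mul two_ne_zero hr0.ne']
    ring
  rw [hlog] at h
  have hsum := sum_le_hasSum {0} (fun k _ => by positivity) h
  calc 2 * (r - 1) / (r + 1) = 2 * w := by rw [← hw]; ring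
    _ = ∑ k ∈ ({0} : Finset ℕ), 2 * (1 / (2 * (k : ℝ) + 1)) * w ^ (2 * k + 1) := by simp
    _ ≤ Real.log r := hsum

/-- The distance between the normalisations of two nonzero vectors:
`‖u/‖u‖ − v/‖v‖‖ ≤ 2‖u − v‖/‖u‖` (hence `≤ 2‖u−v‖ / max(‖u‖,‖v‖)`, the last display of the
proof of Lemma 2.2 (1)). [folklore] -/
theorem norm_normalize_sub_normalize_le {V : Type*} [NormedAddCommGroup V] [NormedSpace ℂ V]
    {u v : V} (hu : u ≠ 0) (hv : v ≠ 0) :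
    ‖((‖u‖⁻¹ : ℝ) : ℂ) • u - ((‖v‖⁻¹ : ℝ) : ℂ) • v‖ ≤ 2 * ‖u - v‖ / ‖u‖ := by
  have hu0 : 0 < ‖u‖ := norm_pos_iff.2 hu
  have hv0 : 0 < ‖v‖ := norm_pos_iff.2 hv
  have hdecomp : ((‖u‖⁻¹ : ℝ) : ℂ) • u - ((‖v‖⁻¹ : ℝ) : ℂ) • v =
      ((‖u‖⁻¹ : ℝ) : ℂ) • (u - v) + ((‖u‖⁻¹ - ‖v‖⁻¹ : ℝ) : ℂ) • v := by
    push_cast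
    module
  have h1 : ‖((‖u‖⁻¹ : ℝ) : ℂ) • (u - v)‖ = ‖u - v‖ / ‖u‖ := by
    rw [norm_smul, Complex.norm_real, Real.norm_of_nonneg (inv_nonneg.2 hu0.le),
      inv_mul_eq_div]
  have h2 : ‖((‖u‖⁻¹ - ‖v‖⁻¹ : ℝ) : ℂ) • v‖ ≤ ‖u - v‖ / ‖u‖ := by
    rw [norm_smul, Complex.norm_real, Real.norm_eq_abs, le_div_iff₀ hu0]
    calc |‖u‖⁻¹ - ‖v‖⁻¹| * ‖v‖ * ‖u‖ = |(‖u‖⁻¹ - ‖v‖⁻¹) * ‖v‖ * ‖u‖| := by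
          rw [abs_mul, abs_mul, abs_of_pos hv0, abs_of_pos hu0]
      _ = |‖v‖ - ‖u‖| := by
          rw [sub_mul, sub_mul, mul_right_comm ‖u‖⁻¹ ‖v‖ ‖u‖, inv_mul_cancel₀ hu0.ne',
            inv_mul_cancel₀ hv0.ne', one_mul, one_mul]
      _ ≤ ‖u - v‖ := by
          rw [abs_sub_comm]
          exact abs_norm_sub_norm_le u v
  calc ‖((‖u‖⁻¹ : ℝ) : ℂ) • u - ((‖v‖⁻¹ : ℝ) : ℂ) • v‖
      = ‖((‖u‖⁻¹ : ℝ) : ℂ) • (u - v) + ((‖u‖⁻¹ - ‖v‖⁻¹ : ℝ) : ℂ) • v‖ := by rw [hdecomp]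
    _ ≤ ‖((‖u‖⁻¹ : ℝ) : ℂ) • (u - v)‖ + ‖((‖u‖⁻¹ - ‖v‖⁻¹ : ℝ) : ℂ) • v‖ := norm_add_le _ _
    _ ≤ ‖u - v‖ / ‖u‖ + ‖u - v‖ / ‖u‖ := by rw [h1]; exact add_le_add le_rfl h2
    _ = 2 * ‖u - v‖ / ‖u‖ := by ring

/-! ### Step 2: the heart of the printed proof (p. 6), for the rescaled pair `x', y'` -/

/-- The central estimate of the proof of Dubois 2009, Lemma 2.2 (1), p. 6, abstracted: if for
all real `t` below `a' ≤ 1`, resp. above `b' ≥ 1`, the vector `t x' − y'` satisfies the aperture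
bound `‖t x' − y'‖ ≤ K' |t − 1|` (in print: `t x' − y' ∈ C ∩ P` and (2.10) with
`⟨m, t x' − y'⟩ = t − 1`), then `‖x' − y'‖ ≤ (K'/2) log(b'/a')`. Printed chain: for
`0 < a < a'`, `b > b'`,
`‖x'−y'‖ ≤ (b−1)/(b−a) ‖ax'−y'‖ + (1−a)/(b−a) ‖bx'−y'‖ ≤ 2K'(b−1)(1−a)/(b−a)
 ≤ 2K'(√b−√a)/(√b+√a) ≤ (K'/2) log(b/a)`, then `a ↑ a'`, `b ↓ b'`.
[cite: Dubois2009, proof of Lemma 2.2 (1)] -/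
theorem norm_sub_le_half_mul_log {V : Type*} [NormedAddCommGroup V] [NormedSpace ℂ V]
    {x' y' : V} {K' a' b' : ℝ} (hK : 0 < K') (ha : 0 < a') (ha1 : a' ≤ 1) (hb1 : 1 ≤ b')
    (hlow : ∀ t : ℝ, 0 < t → t < a' → ‖(t : ℂ) • x' - y'‖ ≤ K' * (1 - t))
    (hhigh : ∀ t : ℝ, b' < t → ‖(t : ℂ) • x' - y'‖ ≤ K' * (t - 1)) :
    ‖x' - y'‖ ≤ K' / 2 * Real.log (b' / a') := by
  have hb : 0 < b' := one_pos.trans_le hb1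
  -- square-root variables `α₀ = √a'`, `β₀ = √b'`
  obtain ⟨α₀, hα₀⟩ : ∃ α₀ : ℝ, Real.sqrt a' = α₀ := ⟨_, rfl⟩
  obtain ⟨β₀, hβ₀⟩ : ∃ β₀ : ℝ, Real.sqrt b' = β₀ := ⟨_, rfl⟩
  have hα₀pos : 0 < α₀ := by rw [← hα₀]; exact Real.sqrt_pos.2 ha
  have hβ₀pos : 0 < β₀ := by rw [← hβ₀]; exact Real.sqrt_pos.2 hb
  have hα₀1 : α₀ ≤ 1 :=
    calc α₀ = Real.sqrt a' := hα₀.symm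
      _ ≤ Real.sqrt 1 := Real.sqrt_le_sqrt ha1
      _ = 1 := Real.sqrt_one
  have hβ₀1 : 1 ≤ β₀ :=
    calc (1 : ℝ) = Real.sqrt 1 := Real.sqrt_one.symm
      _ ≤ Real.sqrt b' := Real.sqrt_le_sqrt hb1
      _ = β₀ := hβ₀
  have hα₀sq : α₀ ^ 2 = a' := by rw [← hα₀]; exact Real.sq_sqrt ha.le
  have hβ₀sq : β₀ ^ 2 = b' := by rw [← hβ₀]; exact Real.sq_sqrt hb.le
  have hlog : Real.log (b' / a') = 2 * (Real.log β₀ - Real.log α₀) := by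
    rw [Real.log_div hb.ne' ha.ne', ← hβ₀, ← hα₀, Real.log_sqrt hb.le, Real.log_sqrt ha.le]
    ring
  rw [hlog]
  refine le_of_forall_pos_lt_add fun ε hε => ?_
  -- the approximating radii `a = α²`, `b = β²` with `α = α₀ e^{-s}`, `β = β₀ e^{s}`
  obtain ⟨s, hs⟩ : ∃ s : ℝ, ε / (4 * K') = s := ⟨_, rfl⟩
  have hs0 : 0 < s := by rw [← hs]; positivity
  obtain ⟨α, hαdef⟩ : ∃ α : ℝ, α₀ * Real.exp (-s) = α := ⟨_, rfl⟩
  obtain ⟨β, hβdef⟩ : ∃ β : ℝ, β₀ * Real.exp s = β := ⟨_, rfl⟩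
  have hαpos : 0 < α := by rw [← hαdef]; exact mul_pos hα₀pos (Real.exp_pos _)
  have hα_lt : α < α₀ := by
    rw [← hαdef]
    exact mul_lt_of_lt_one_right hα₀pos (Real.exp_lt_one_iff.2 (neg_lt_zero.2 hs0))
  have hβ_gt : β₀ < β := by
    rw [← hβdef]
    exact lt_mul_of_one_lt_right hβ₀pos (Real.one_lt_exp_iff.2 hs0)
  have hα1 : α < 1 := hα_lt.trans_le hα₀1
  have hβ1 : 1 < β := hβ₀1.trans_lt hβ_gt
  have hβpos : 0 < β := one_pos.trans hβ1
  have hαβ : α < β := hα1.trans hβ1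
  have ha_lt : α ^ 2 < a' := by
    rw [← hα₀sq]
    exact pow_lt_pow_left₀ hα_lt hαpos.le two_ne_zero
  have hb_lt : b' < β ^ 2 := by
    rw [← hβ₀sq]
    exact pow_lt_pow_left₀ hβ_gt hβ₀pos.le two_ne_zero
  have h1 := hlow (α ^ 2) (by positivity) ha_lt
  have h2 := hhigh (β ^ 2) hb_lt
  -- the convex combination `x' − y' = (b−1)/(b−a) (a x' − y') + (1−a)/(b−a) (b x' − y')`
  have hba : 0 < β ^ 2 - α ^ 2 := by
    nlinarith [mul_pos (sub_pos.2 hαβ) (add_pos hαpos hβpos)]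
  have hbane : β ^ 2 - α ^ 2 ≠ 0 := hba.ne'
  obtain ⟨c₁, hc₁⟩ : ∃ c : ℝ, (β ^ 2 - 1) / (β ^ 2 - α ^ 2) = c := ⟨_, rfl⟩
  obtain ⟨c₂, hc₂⟩ : ∃ c : ℝ, (1 - α ^ 2) / (β ^ 2 - α ^ 2) = c := ⟨_, rfl⟩
  have hc₁0 : 0 ≤ c₁ := by
    rw [← hc₁]
    exact div_nonneg (by nlinarith [hβ1]) hba.le
  have hc₂0 : 0 ≤ c₂ := by
    rw [← hc₂]
    exact div_nonneg (by nlinarith [hα1, hαpos]) hba.le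
  have hsum1 : c₁ + c₂ = 1 := by
    rw [← hc₁, ← hc₂, ← add_div, div_eq_one_iff_eq hbane]
    ring
  have hsum2 : c₁ * α ^ 2 + c₂ * β ^ 2 = 1 := by
    rw [← hc₁, ← hc₂, div_mul_eq_mul_div, div_mul_eq_mul_div, ← add_div,
      div_eq_one_iff_eq hbane]
    ring
  have hdecomp : x' - y' = (c₁ : ℂ) • (((α ^ 2 : ℝ) : ℂ) • x' - y') +
      (c₂ : ℂ) • (((β ^ 2 : ℝ) : ℂ) • x' - y') := by
    have e1 : (c₁ : ℂ) * ((α ^ 2 : ℝ) : ℂ) + (c₂ : ℂ) * ((β ^ 2 : ℝ) : ℂ) = 1 := by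
      exact_mod_cast hsum2
    have e2 : (c₁ : ℂ) + (c₂ : ℂ) = 1 := by exact_mod_cast hsum1
    calc x' - y' = ((c₁ : ℂ) * ((α ^ 2 : ℝ) : ℂ) + (c₂ : ℂ) * ((β ^ 2 : ℝ) : ℂ)) • x' -
          ((c₁ : ℂ) + (c₂ : ℂ)) • y' := by rw [e1, e2, one_smul, one_smul]
      _ = (c₁ : ℂ) • (((α ^ 2 : ℝ) : ℂ) • x' - y') +
          (c₂ : ℂ) • (((β ^ 2 : ℝ) : ℂ) • x' - y') := by module
  have hnorm : ‖x' - y'‖ ≤ c₁ * (K' * (1 - α ^ 2)) + c₂ * (K' * (β ^ 2 - 1)) := by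
    calc ‖x' - y'‖ = ‖(c₁ : ℂ) • (((α ^ 2 : ℝ) : ℂ) • x' - y') +
          (c₂ : ℂ) • (((β ^ 2 : ℝ) : ℂ) • x' - y')‖ := by rw [← hdecomp]
      _ ≤ ‖(c₁ : ℂ) • (((α ^ 2 : ℝ) : ℂ) • x' - y')‖ +
          ‖(c₂ : ℂ) • (((β ^ 2 : ℝ) : ℂ) • x' - y')‖ := norm_add_le _ _
      _ = c₁ * ‖((α ^ 2 : ℝ) : ℂ) • x' - y'‖ + c₂ * ‖((β ^ 2 : ℝ) : ℂ) • x' - y'‖ := by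
          rw [norm_smul, norm_smul, Complex.norm_real, Complex.norm_real,
            Real.norm_of_nonneg hc₁0, Real.norm_of_nonneg hc₂0]
      _ ≤ c₁ * (K' * (1 - α ^ 2)) + c₂ * (K' * (β ^ 2 - 1)) :=
          add_le_add (mul_le_mul_of_nonneg_left h1 hc₁0) (mul_le_mul_of_nonneg_left h2 hc₂0)
  -- `2K'(b−1)(1−a)/(b−a) ≤ 2K'(β−α)/(β+α) ≤ K' log(β/α)`
  have hkey : c₁ * (K' * (1 - α ^ 2)) + c₂ * (K' * (β ^ 2 - 1)) =
      2 * K' * ((β ^ 2 - 1) * (1 - α ^ 2) / (β ^ 2 - α ^ 2)) := by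
    rw [← hc₁, ← hc₂, div_mul_eq_mul_div, div_mul_eq_mul_div, ← add_div, ← mul_div_assoc,
      div_left_inj' hbane]
    ring
  have hβα : 0 < β + α := add_pos hβpos hαpos
  have hstep : (β ^ 2 - 1) * (1 - α ^ 2) / (β ^ 2 - α ^ 2) ≤ (β - α) / (β + α) := by
    rw [div_le_div_iff₀ hba hβα]
    nlinarith [mul_nonneg hβα.le (sq_nonneg (α * β - 1))]
  have hL : 2 * (β - α) / (β + α) ≤ Real.log β - Real.log α := by
    have h := two_mul_sub_one_div_add_one_le_log (r := β / α)
      (by rw [le_div_iff₀ hαpos]; linarith)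
    rw [Real.log_div hβpos.ne' hαpos.ne'] at h
    have e : 2 * (β / α - 1) / (β / α + 1) = 2 * (β - α) / (β + α) := by
      rw [div_sub_one hαpos.ne', div_add_one hαpos.ne', mul_div_assoc', div_div_div_cancel_right₀ hαpos.ne']
    rwa [e] at h
  have hlogβ : Real.log β = Real.log β₀ + s := by
    rw [← hβdef, Real.log_mul hβ₀pos.ne' (Real.exp_pos s).ne', Real.log_exp]
  have hlogα : Real.log α = Real.log α₀ - s := by
    rw [← hαdef, Real.log_mul hα₀pos.ne' (Real.exp_pos _).ne', Real.log_exp]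
    ring
  have hKs : 2 * K' * s = ε / 2 := by
    rw [← hs, mul_div_assoc', div_eq_div_iff (by positivity) two_ne_zero]
    ring
  calc ‖x' - y'‖ ≤ c₁ * (K' * (1 - α ^ 2)) + c₂ * (K' * (β ^ 2 - 1)) := hnorm
    _ = 2 * K' * ((β ^ 2 - 1) * (1 - α ^ 2) / (β ^ 2 - α ^ 2)) := hkey
    _ ≤ 2 * K' * ((β - α) / (β + α)) := mul_le_mul_of_nonneg_left hstep (by positivity)
    _ = K' * (2 * (β - α) / (β + α)) := by ring
    _ ≤ K' * (Real.log β - Real.log α) := mul_le_mul_of_nonneg_left hL hK.le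
    _ = K' / 2 * (2 * (Real.log β₀ - Real.log α₀)) + 2 * K' * s := by rw [hlogβ, hlogα]; ring
    _ < K' / 2 * (2 * (Real.log β₀ - Real.log α₀)) + ε := by rw [hKs]; linarith

/-! ### Step 3: Lemma 2.2 (1) -/

/-- **Dubois 2009, Lemma 2.2 (1)** — discharge of the named fact `Dubois2009_lemma_2_2_1`
(statement unchanged in `ComplexConeContraction.lean`): for a proper complex cone `C` of
`K`-bounded sectional aperture (`K ≥ 1`) in a complex Banach space and `x, y ∈ C` with
`‖x‖ = ‖y‖ = 1` there is `α ∈ ℂ`, `|α| = 1`, with `‖α y − x‖ ≤ K δ_C(x, y)`. The proof is the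
printed one (p. 6), see the module docstring. [cite: Dubois2009, Lemma 2.2 (1)] -/
theorem Dubois2009_lemma_2_2_1_holds : Dubois2009_lemma_2_2_1 := by
  intro V _ _ _ C K hK hC hA x hx y hy hx1 hy1
  have hKpos : 0 < K := one_pos.trans_le hK
  have hx0 : x ≠ 0 := by
    rintro rfl
    simp at hx1
  have hy0 : y ≠ 0 := by
    rintro rfl
    simp at hy1
  by_cases hli : LinearIndependent ℂ ![x, y]
  swap
  · -- colinear pairs: `y = a • x` with `|a| = 1`, and `δ = 0`
    rw [duboisDelta_of_not_linearIndependent hli, mul_zero]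
    obtain ⟨a, rfl⟩ : ∃ a : ℂ, a • x = y := by
      by_contra h
      push Not at h
      exact hli ((LinearIndependent.pair_iff' hx0).mpr h)
    have ha1 : ‖a‖ = 1 := by
      rw [norm_smul, hx1, mul_one] at hy1
      exact hy1
    have ha0 : a ≠ 0 := fun h => by
      rw [h, norm_zero] at ha1
      exact zero_ne_one ha1
    refine ⟨a⁻¹, by rw [norm_inv, ha1, inv_one], ?_⟩
    rw [smul_smul, inv_mul_cancel₀ ha0, one_smul, sub_self, norm_zero]
    simp
  -- the plane `P = span {x, y}` and the functional `m = m_P` of (2.10)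
  obtain ⟨P, hP⟩ : ∃ P : Submodule ℂ V, Submodule.span ℂ (Set.range ![x, y]) = P := ⟨_, rfl⟩
  have hrank : Module.finrank ℂ P = 2 := by
    rw [← hP, finrank_span_eq_card hli, Fintype.card_fin]
  have hxP : x ∈ P := by
    rw [← hP]
    exact Submodule.subset_span ⟨0, rfl⟩
  have hyP : y ∈ P := by
    rw [← hP]
    exact Submodule.subset_span ⟨1, rfl⟩
  obtain ⟨m, hm0, hm⟩ := hA P hrank
  have hmpos : 0 < ‖m‖ := norm_pos_iff.2 hm0
  have hmne : ‖m‖ ≠ 0 := hmpos.ne'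
  have hap : ∀ u ∈ C, u ∈ P → ‖u‖ ≤ K / ‖m‖ * ‖m u‖ := by
    intro u huC huP
    rw [div_mul_eq_mul_div, le_div_iff₀ hmpos]
    calc ‖u‖ * ‖m‖ = ‖m‖ * ‖u‖ := mul_comm _ _
      _ ≤ K * ‖m u‖ := hm u ⟨huC, huP⟩
  -- `p = ⟨m,x⟩`, `q = ⟨m,y⟩` are nonzero; `x' = x/p`, `y' = y/q`
  obtain ⟨p, hp⟩ : ∃ p : ℂ, m x = p := ⟨_, rfl⟩
  obtain ⟨q, hq⟩ : ∃ q : ℂ, m y = q := ⟨_, rfl⟩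
  have hp0 : p ≠ 0 := by
    intro h
    have h' := hm x ⟨hx, hxP⟩
    rw [hx1, mul_one, hp, h, norm_zero, mul_zero] at h'
    exact absurd h' (not_le.2 hmpos)
  have hq0 : q ≠ 0 := by
    intro h
    have h' := hm y ⟨hy, hyP⟩
    rw [hy1, mul_one, hq, h, norm_zero, mul_zero] at h'
    exact absurd h' (not_le.2 hmpos)
  have hple : ‖p‖ ≤ ‖m‖ := by simpa [hx1, hp] using m.le_opNorm x
  have hppos : 0 < ‖p‖ := norm_pos_iff.2 hp0
  have hqpos : 0 < ‖q‖ := norm_pos_iff.2 hq0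
  obtain ⟨x', hx'⟩ : ∃ x' : V, p⁻¹ • x = x' := ⟨_, rfl⟩
  obtain ⟨y', hy'⟩ : ∃ y' : V, q⁻¹ • y = y' := ⟨_, rfl⟩
  have hmx' : m x' = 1 := by rw [← hx', map_smul, smul_eq_mul, hp, inv_mul_cancel₀ hp0]
  have hmy' : m y' = 1 := by rw [← hy', map_smul, smul_eq_mul, hq, inv_mul_cancel₀ hq0]
  have hx'P : x' ∈ P := by
    rw [← hx']
    exact P.smul_mem _ hxP
  have hy'P : y' ∈ P := by
    rw [← hy']
    exact P.smul_mem _ hyP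
  have hx'0 : x' ≠ 0 := by
    rw [← hx']
    exact smul_ne_zero (inv_ne_zero hp0) hx0
  have hy'0 : y' ≠ 0 := by
    rw [← hy']
    exact smul_ne_zero (inv_ne_zero hq0) hy0
  have hnx' : ‖x'‖ = ‖p‖⁻¹ := by rw [← hx', norm_smul, norm_inv, hx1, mul_one]
  have hny' : ‖y'‖ = ‖q‖⁻¹ := by rw [← hy', norm_smul, norm_inv, hy1, mul_one]
  -- `t x' − y' = q⁻¹ ((t q / p) x − y)`: `E(x',y') = (p/q) E(x,y)`
  have hscale : ∀ t : ℂ, t • x' - y' = q⁻¹ • ((t * q * p⁻¹) • x - y) := by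
    intro t
    have e : q⁻¹ * (t * q * p⁻¹) = t * p⁻¹ := by
      rw [show q⁻¹ * (t * q * p⁻¹) = t * p⁻¹ * (q⁻¹ * q) by ring, inv_mul_cancel₀ hq0, mul_one]
    rw [← hx', ← hy']
    simp only [smul_sub, smul_smul]
    rw [e]
  have hmemC : ∀ t : ℂ, t * q * p⁻¹ ∉ duboisE C x y → t • x' - y' ∈ C := by
    intro t ht
    have ht' : (t * q * p⁻¹) • x - y ∈ C := by
      by_contra h'
      exact ht h'
    rw [hscale t]
    exact hC.1.2 _ (inv_ne_zero hq0) _ ht'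
  -- "`1 ∈ E_C(x', y')`", i.e. `q/p ∈ E_C(x, y)`
  have hx'y'C : x' - y' ∉ C := by
    intro h
    have hle := hap _ h (P.sub_mem hx'P hy'P)
    rw [map_sub, hmx', hmy', sub_self, norm_zero, mul_zero] at hle
    have heq : x' - y' = 0 := norm_le_zero_iff.1 hle
    rw [← hx', ← hy'] at heq
    have h2 := (LinearIndependent.pair_iff.1 hli) p⁻¹ (-q⁻¹)
      (by rw [neg_smul, ← sub_eq_add_neg]; exact heq)
    exact inv_ne_zero hp0 h2.1
  have hz₀ : q * p⁻¹ ∈ duboisE C x y := by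
    show (q * p⁻¹) • x - y ∉ C
    intro hmem
    apply hx'y'C
    have h := hC.1.2 _ (inv_ne_zero hq0) _ hmem
    have e : x' - y' = q⁻¹ • ((q * p⁻¹) • x - y) := by
      rw [← one_smul ℂ x', hscale 1, one_mul]
    rwa [e]
  have hz₀0 : q * p⁻¹ ≠ 0 := mul_ne_zero hq0 (inv_ne_zero hp0)
  obtain ⟨μ, hμ⟩ : ∃ μ : ℝ, ‖q * p⁻¹‖ = μ := ⟨_, rfl⟩
  have hμpos : 0 < μ := by rw [← hμ]; exact norm_pos_iff.2 hz₀0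
  -- `δ_C(x,y) = log (sup|E| / inf|E|)`; the infinite cases are trivial
  rw [duboisDelta_of_linearIndependent hli]
  have hS0 : (⨆ z ∈ duboisE C x y, (‖z‖₊ : ℝ≥0∞)) ≠ 0 :=
    ((ENNReal.ofReal_pos.2 (norm_pos_iff.2 hz₀0)).trans_le (ofReal_norm_le_biSup hz₀)).ne'
  have hItop : (⨅ z ∈ duboisE C x y, (‖z‖₊ : ℝ≥0∞)) ≠ ⊤ :=
    ne_top_of_le_ne_top ENNReal.ofReal_ne_top (biInf_le_ofReal_norm hz₀)
  by_cases hdeg : (⨅ z ∈ duboisE C x y, (‖z‖₊ : ℝ≥0∞)) = 0 ∨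
      (⨆ z ∈ duboisE C x y, (‖z‖₊ : ℝ≥0∞)) = ⊤
  · have htop : (⨆ z ∈ duboisE C x y, (‖z‖₊ : ℝ≥0∞)) /
        (⨅ z ∈ duboisE C x y, (‖z‖₊ : ℝ≥0∞)) = ⊤ := by
      rcases hdeg with h | h
      · rw [h]; exact ENNReal.div_zero hS0
      · rw [h]; exact ENNReal.top_div_of_ne_top hItop
    refine ⟨1, norm_one, ?_⟩
    rw [htop, ENNReal.log_top, EReal.coe_mul_top_of_pos hKpos]
    exact le_top
  have hI0 : (⨅ z ∈ duboisE C x y, (‖z‖₊ : ℝ≥0∞)) ≠ 0 := fun h => hdeg (Or.inl h)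
  have hStop : (⨆ z ∈ duboisE C x y, (‖z‖₊ : ℝ≥0∞)) ≠ ⊤ := fun h => hdeg (Or.inr h)
  obtain ⟨a₀, ha₀⟩ : ∃ a₀ : ℝ, (⨅ z ∈ duboisE C x y, (‖z‖₊ : ℝ≥0∞)).toReal = a₀ := ⟨_, rfl⟩
  obtain ⟨b₀, hb₀⟩ : ∃ b₀ : ℝ, (⨆ z ∈ duboisE C x y, (‖z‖₊ : ℝ≥0∞)).toReal = b₀ := ⟨_, rfl⟩
  have ha₀pos : 0 < a₀ := by rw [← ha₀]; exact ENNReal.toReal_pos hI0 hItop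
  have hlo : ∀ z ∈ duboisE C x y, a₀ ≤ ‖z‖ := fun z hz => by
    rw [← ha₀]
    exact ENNReal.toReal_le_of_le_ofReal (norm_nonneg _) (biInf_le_ofReal_norm hz)
  have hhi : ∀ z ∈ duboisE C x y, ‖z‖ ≤ b₀ := fun z hz => by
    rw [← hb₀]
    exact (ENNReal.ofReal_le_iff_le_toReal hStop).1 (ofReal_norm_le_biSup hz)
  have hlogSI : ENNReal.log ((⨆ z ∈ duboisE C x y, (‖z‖₊ : ℝ≥0∞)) /
      (⨅ z ∈ duboisE C x y, (‖z‖₊ : ℝ≥0∞))) = ((Real.log (b₀ / a₀) : ℝ) : EReal) := by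
    rw [ENNReal.log_pos_real (ENNReal.div_pos_iff.2 ⟨hS0, hItop⟩).ne'
      (ENNReal.div_lt_top hStop hI0).ne, ENNReal.toReal_div, ha₀, hb₀]
  rw [hlogSI, ← EReal.coe_mul]
  -- the one-sided aperture bounds for `t x' − y'`, `t < a' = a₀/μ ≤ 1` and `t > b' = b₀/μ ≥ 1`
  have ha'1 : a₀ / μ ≤ 1 := by rw [div_le_one hμpos, ← hμ]; exact hlo _ hz₀
  have hb'1 : 1 ≤ b₀ / μ := by rw [one_le_div hμpos, ← hμ]; exact hhi _ hz₀
  have ha'pos : 0 < a₀ / μ := div_pos ha₀pos hμpos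
  have hbound : ∀ t : ℝ, (t : ℂ) * q * p⁻¹ ∉ duboisE C x y →
      ‖(t : ℂ) • x' - y'‖ ≤ K / ‖m‖ * |t - 1| := by
    intro t hnotin
    have h := hap _ (hmemC (t : ℂ) hnotin) (P.sub_mem (P.smul_mem _ hx'P) hy'P)
    rw [map_sub, map_smul, smul_eq_mul, hmx', hmy', mul_one] at h
    rwa [show (t : ℂ) - 1 = ((t - 1 : ℝ) : ℂ) by push_cast; ring, Complex.norm_real,
      Real.norm_eq_abs] at h
  have hnormt : ∀ t : ℝ, 0 < t → ‖(t : ℂ) * q * p⁻¹‖ = t * μ := by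
    intro t ht
    rw [mul_assoc, norm_mul, Complex.norm_real, Real.norm_of_nonneg ht.le, hμ]
  have hlow : ∀ t : ℝ, 0 < t → t < a₀ / μ → ‖(t : ℂ) • x' - y'‖ ≤ K / ‖m‖ * (1 - t) := by
    intro t ht0 hta
    have ht1 : t < 1 := hta.trans_le ha'1
    have hnotin : (t : ℂ) * q * p⁻¹ ∉ duboisE C x y := by
      intro hin
      have h1 := hlo _ hin
      rw [hnormt t ht0] at h1
      have h2 := (lt_div_iff₀ hμpos).1 hta
      linarith
    have h := hbound t hnotin
    rwa [abs_of_neg (sub_neg.2 ht1), neg_sub] at h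
  have hhigh : ∀ t : ℝ, b₀ / μ < t → ‖(t : ℂ) • x' - y'‖ ≤ K / ‖m‖ * (t - 1) := by
    intro t htb
    have ht1 : 1 < t := hb'1.trans_lt htb
    have ht0 : 0 < t := one_pos.trans ht1
    have hnotin : (t : ℂ) * q * p⁻¹ ∉ duboisE C x y := by
      intro hin
      have h1 := hhi _ hin
      rw [hnormt t ht0] at h1
      have h2 := (div_lt_iff₀ hμpos).1 htb
      linarith
    have h := hbound t hnotin
    rwa [abs_of_pos (sub_pos.2 ht1)] at h
  -- the heart of the proof: `‖x' − y'‖ ≤ (K / 2‖m‖) log(b₀/a₀)`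
  have hcore := norm_sub_le_half_mul_log (div_pos hKpos hmpos) ha'pos ha'1 hb'1 hlow hhigh
  have hratio : b₀ / μ / (a₀ / μ) = b₀ / a₀ := by
    rw [div_div_div_cancel_right₀ hμpos.ne']
  rw [hratio] at hcore
  -- normalisation: `‖ |p| x' − |q| y' ‖ ≤ 2 |p| ‖x' − y'‖ ≤ 2 ‖m‖ ‖x' − y'‖`
  have hN := norm_normalize_sub_normalize_le hx'0 hy'0
  rw [hnx', hny', inv_inv, inv_inv, div_inv_eq_mul] at hN
  obtain ⟨β, hβ⟩ : ∃ β : ℂ, ((‖p‖ : ℝ) : ℂ) * p⁻¹ = β := ⟨_, rfl⟩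
  obtain ⟨γ, hγ⟩ : ∃ γ : ℂ, ((‖q‖ : ℝ) : ℂ) * q⁻¹ = γ := ⟨_, rfl⟩
  have hβ1 : ‖β‖ = 1 := by
    rw [← hβ, norm_mul, norm_inv, Complex.norm_real, Real.norm_of_nonneg (norm_nonneg _),
      mul_inv_cancel₀ hppos.ne']
  have hγ1 : ‖γ‖ = 1 := by
    rw [← hγ, norm_mul, norm_inv, Complex.norm_real, Real.norm_of_nonneg (norm_nonneg _),
      mul_inv_cancel₀ hqpos.ne']
  have hβ0 : β ≠ 0 := fun h => by
    rw [h, norm_zero] at hβ1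
    exact zero_ne_one hβ1
  refine ⟨β⁻¹ * γ, by rw [norm_mul, norm_inv, hβ1, hγ1, inv_one, one_mul], ?_⟩
  rw [EReal.coe_le_coe_iff]
  have e : (β⁻¹ * γ) • y - x = β⁻¹ • (γ • y - β • x) := by
    rw [smul_sub, smul_smul, smul_smul, inv_mul_cancel₀ hβ0, one_smul]
  have e2 : γ • y - β • x = -(((‖p‖ : ℝ) : ℂ) • x' - ((‖q‖ : ℝ) : ℂ) • y') := by
    rw [← hβ, ← hγ, ← hx', ← hy', smul_smul, smul_smul, neg_sub]
  rw [e, norm_smul, norm_inv, hβ1, inv_one, one_mul, e2, norm_neg]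
  calc ‖((‖p‖ : ℝ) : ℂ) • x' - ((‖q‖ : ℝ) : ℂ) • y'‖ ≤ 2 * ‖x' - y'‖ * ‖p‖ := hN
    _ = 2 * (‖x' - y'‖ * ‖p‖) := by ring
    _ ≤ 2 * (K / ‖m‖ / 2 * Real.log (b₀ / a₀) * ‖m‖) :=
        mul_le_mul_of_nonneg_left (mul_le_mul hcore hple hppos.le ((norm_nonneg _).trans hcore))
          two_pos.le
    _ = K / ‖m‖ * ‖m‖ * Real.log (b₀ / a₀) := by ring
    _ = K * Real.log (b₀ / a₀) := by rw [div_mul_cancel₀ K hmne]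

end Literature.Dynamics.Contraction

end
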